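import Summits.PneNP.PneNP.Theorems.PhaseTwinsPolyDepthTwinsAboveDefs

/-!
# Route PhaseTwins, crux `PolyDepthTwinsAbove` (stmt-PneNP-2719), line `parity-wired-ports`: stub `stub_tseitinGap`

The Tseitin ENERGY GAP of the parity-wired graphs (registered stub `stub_tseitinGap`, the energy half of the
line; it feeds `twins_of_estimates` in `PolyDepthTwinsAbove_of`): over a 3-regular base without half-edges,
with `g = Ψ(0) − Ψ(1) ≥ 0` and the coupling hypothesis `κ₂ (M log ρ_F + g) ≤ κ₁ log B` (`B = slyB q⁺ q⁻ > 1`),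
`pwW (1_{w₀}) Y · e^{κ₂ g} ≤ pwW 0 Y₀` for EVERY phase vector `Y`, where `Y₀ (δ, a) = (a = 0)`.

Proof (finite optimisation over phase vectors; elementary facts about the explicit weights first).
* The complex factor: `F_e ≥ 1 > 0` (empty independent set), so `e^{Ψ(e)} = cxW e ref`; it is monotone in the
  vacancies, so it lies between the all-`+` and the all-`−` factor; TSEITIN COVARIANCE
  `cxW e (y ∘ shift β) = cxW (e + Σβ) y` (the gauge map `(i,a) ↦ (i, a + β i)`, `S' ↦ S' + β|₀₁` is an
  isomorphism `cxGraph e ≅ cxGraph (e + Σβ)`, `CFIMatching.bit_shift`), whence constant configurations weigh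
  the same under both charges.
* Pair factors: the anti-aligned value `A` dominates every pair factor and an aligned pair weighs `A / B^{κ₁}`;
  `pwW 0 Y₀ = Π_{canonical δ} A · Π_w (e^{Ψ(0)})^{κ₂}`.
* All canonical pairs of `Y` anti-aligned (`tg_cxProd_anti`, no slack): with the edge bits `β` (`0` iff the
  canonical copy of the edge is in phase `+`; constant on edges because both darts of an edge plug into its
  canonical dart — this uses `NoFixed`), the complex at `w` reads `ref` shifted by `β (w, ·)` and weighs
  `e^{Ψ(c w + Σ_i β (w, i))}`; the darts pair up under `rot`, so `Σ_δ β δ = 0` and the local charges sum to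
  `Σ c = 1`: one complex is violated (`e^{κ₂ Ψ(1)}`), the others give at most `e^{κ₂ Ψ(0)}` each (`hΨ`).
* Some canonical pair aligned: the pair product loses `B^{κ₁}`, the complexes gain at most `ρ_F^{κ₂ M}` over
  `F_min^{κ₂ M} ≤ e^{κ₂ M Ψ(0)}`, and `hcouple` pays the difference (`tg_cxProd_general`).
-/

noncomputable section

open scoped Classical BigOperators

namespace Summit.PneNP.PneNP.Cruxes.PolyDepthTwinsAbove.ParityWiredPorts

open Finset
open Literature.Computability.Complexity (slyB one_lt_slyB)
open Literature.Computability.Complexity.Expander (RotGraph)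
open Literature.ModelTheory.FiniteModelTheory.TseitinColouring (Dart bd)
open Literature.ModelTheory.FiniteModelTheory.CFIMatching (bit Canon NoFixed code code_injective
  zmod2_add_self zmod2_eq_zero_or_one bit_shift)

set_option linter.dupNamespace false

variable {M v m κ₁ κ₂ : ℕ}

/-! ## The complex factor: positivity, monotonicity, Tseitin covariance -/

/-- **The complex factor is positive** (`λ ≥ 0`, `q± ≤ 1`): the empty independent set alone contributes
`(1+λ)^{-10}`, and every other term is nonnegative. -/
theorem tg_cxW_pos {lam qp qm : ℝ} (hlam : 0 ≤ lam) (hqp : qp ≤ 1) (hqm : qm ≤ 1) (e : ZMod 2)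
    (y : Fin 3 × ZMod 2 → Bool) : 0 < cxW lam qp qm e y := by
  have hx : ∀ p, 0 ≤ 1 - occP qp qm (y p) := fun p => by cases y p <;> simp [occP] <;> assumption
  refine div_pos (zero_lt_one.trans_le ?_) (pow_pos (by linarith) _)
  unfold cxWeight
  set F : Finset CxVert → ℝ := fun J => if (cxGraph e).IsIndepSet (↑J : Set CxVert) then lam ^ J.card *
      ∏ p : Fin 3 × ZMod 2, (if (Sum.inl p : CxVert) ∈ J then 1 - occP qp qm (y p) else 1) else 0 with hF
  have hF0 : F ∅ = 1 := by simp [hF, Set.pairwise_empty]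
  calc (1 : ℝ) = F ∅ := hF0.symm
    _ ≤ ∑ J, F J := Finset.single_le_sum (fun J _ => ?_) (Finset.mem_univ _)
  simp only [hF]
  split_ifs
  · exact mul_nonneg (pow_nonneg hlam _) (Finset.prod_nonneg fun p _ => by
      split_ifs
      exacts [hx p, zero_le_one])
  · exact le_rfl

/-- `exp Ψ(e)` is the complex factor of the reference configuration. -/
theorem tg_exp_pwPsi {lam qp qm : ℝ} (hlam : 0 ≤ lam) (hqp : qp ≤ 1) (hqm : qm ≤ 1) (e : ZMod 2) :
    Real.exp (pwPsi lam qp qm e) = cxW lam qp qm e (fun p => decide (p.2 = 0)) :=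
  Real.exp_log (tg_cxW_pos hlam hqp hqm e _)

/-- Every complex factor lies between the all-`+` factor (vacancies `1 - q⁺`) and the all-`−` factor
(vacancies `1 - q⁻`): the local factor is termwise monotone in the vacancies. -/
theorem tg_cxW_bounds {lam qp qm : ℝ} (hlam : 0 ≤ lam) (hle : qm ≤ qp) (hqp : qp ≤ 1) (e : ZMod 2)
    (y : Fin 3 × ZMod 2 → Bool) : cxW lam qp qm e (fun _ => true) ≤ cxW lam qp qm e y ∧
      cxW lam qp qm e y ≤ cxW lam qp qm e (fun _ => false) := by
  have hb : ∀ s, 1 - qp ≤ 1 - occP qp qm s ∧ 1 - occP qp qm s ≤ 1 - qm := fun s => by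
    cases s <;> simp [occP] <;> linarith
  have hmono : ∀ x x' : Fin 3 × ZMod 2 → ℝ, (∀ p, 0 ≤ x p) → (∀ p, x p ≤ x' p) →
      cxWeight e lam x / (1 + lam) ^ 10 ≤ cxWeight e lam x' / (1 + lam) ^ 10 := fun x x' hx hxx' => by
    refine div_le_div_of_nonneg_right (Finset.sum_le_sum fun J _ => ?_) (pow_nonneg (by linarith) _)
    split_ifs
    · refine mul_le_mul_of_nonneg_left (Finset.prod_le_prod (fun p _ => ?_) fun p _ => ?_) (pow_nonneg hlam _)
      · split_ifs
        exacts [hx p, zero_le_one]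
      · split_ifs
        exacts [hxx' p, le_rfl]
    · exact le_rfl
  refine ⟨hmono _ _ (fun p => ?_) fun p => ?_, hmono _ _ (fun p => ?_) fun p => ?_⟩
  · simp only [occP, if_true]
    linarith
  · exact (hb (y p)).1
  · exact le_trans (by linarith) (hb (y p)).1
  · exact (hb (y p)).2

/-- The represented bits transform additively under the gauge map (`CFIMatching.bit_shift` at one vertex). -/
theorem tg_bit_shift (e : ZMod 2) (β : Fin 3 → ZMod 2) (S' : Fin 2 → ZMod 2) (i : Fin 3) :
    bit (e + ∑ k, β k) (S' + fun k => β (Fin.castSucc k)) i = bit e S' i + β i := by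
  simpa [bd] using bit_shift (M := 1) (fun _ => e) (fun δ => β δ.2) 0 S' i

/-- **Tseitin covariance of the local factor**: reading the vacancies through the bit shift `β` equals changing
the local charge by `Σ β`. The gauge map `(i,a) ↦ (i, a + β i)`, `S' ↦ S' + β|₀₁` is an involution transporting
the inner–end adjacency of charge `e` to that of `e + Σ β`; reindex the independent sets by it and the end
product by the shift of the ends. -/
theorem tg_cxWeight_shift (e : ZMod 2) (lam : ℝ) (β : Fin 3 → ZMod 2) (x : Fin 3 × ZMod 2 → ℝ) :
    cxWeight e lam (fun p => x (p.1, p.2 + β p.1)) = cxWeight (e + ∑ k, β k) lam x := by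
  -- the shift of the ends and the gauge map, as permutations
  have hfinv : Function.Involutive (fun p : Fin 3 × ZMod 2 => (p.1, p.2 + β p.1)) := by
    rintro ⟨i, a⟩
    simp [add_assoc, zmod2_add_self]
  have hginv : Function.Involutive (Sum.map (fun p : Fin 3 × ZMod 2 => (p.1, p.2 + β p.1))
      (fun S' : Fin 2 → ZMod 2 => S' + fun k => β (Fin.castSucc k)) : CxVert → CxVert) := by
    rintro (⟨i, a⟩ | S')
    · simp [add_assoc, zmod2_add_self]
    · simp only [Sum.map_inr, Sum.inr.injEq]
      funext k
      simp [add_assoc, zmod2_add_self]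
  set ψ : Fin 3 × ZMod 2 ≃ Fin 3 × ZMod 2 := hfinv.toPerm _ with hψ
  set φ : CxVert ≃ CxVert := hginv.toPerm _ with hφ
  have hφapp : ∀ u, φ u = Sum.map (fun p : Fin 3 × ZMod 2 => (p.1, p.2 + β p.1))
      (fun S' : Fin 2 → ZMod 2 => S' + fun k => β (Fin.castSucc k)) u := fun u => rfl
  -- the gauge map transports adjacency, hence independent sets
  have hrel : ∀ u v, cxRel (e + ∑ k, β k) (φ u) (φ v) ↔ cxRel e u v := by
    rintro (⟨i, a⟩ | S') (⟨i', a'⟩ | S'') <;> simp only [hφapp, Sum.map_inl, Sum.map_inr, cxRel]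
    rw [tg_bit_shift]
    exact add_left_inj _
  have hadj : ∀ u v, (cxGraph (e + ∑ k, β k)).Adj (φ u) (φ v) ↔ (cxGraph e).Adj u v := fun u v => by
    rw [cxGraph_adj, cxGraph_adj, φ.injective.ne_iff, hrel, hrel]
  have hind : ∀ J : Finset CxVert, (cxGraph (e + ∑ k, β k)).IsIndepSet (↑(J.map φ.toEmbedding) : Set CxVert) ↔
      (cxGraph e).IsIndepSet (↑J : Set CxVert) := by
    intro J
    rw [SimpleGraph.isIndepSet_iff, SimpleGraph.isIndepSet_iff, Finset.coe_map]
    constructor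
    · intro h u hu v hv huv hc
      exact h (Set.mem_image_of_mem _ hu) (Set.mem_image_of_mem _ hv) (φ.injective.ne_iff.2 huv)
        ((hadj u v).2 hc)
    · rintro h _ ⟨u, hu, rfl⟩ _ ⟨v, hv, rfl⟩ huv hc
      exact h hu hv (fun huv' => huv (by rw [huv'])) ((hadj u v).1 hc)
  -- reindex
  refine Fintype.sum_equiv (Equiv.finsetCongr φ) _ _ (fun J => ?_)
  rw [Equiv.finsetCongr_apply]
  by_cases hJ : (cxGraph e).IsIndepSet (↑J : Set CxVert)
  · rw [if_pos hJ, if_pos ((hind J).2 hJ), Finset.card_map]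
    congr 1
    refine Fintype.prod_equiv ψ _ _ (fun p => ?_)
    have hmem : (Sum.inl (ψ p) : CxVert) ∈ J.map φ.toEmbedding ↔ (Sum.inl p : CxVert) ∈ J :=
      Finset.mem_map' φ.toEmbedding (a := Sum.inl p)
    by_cases hp : (Sum.inl p : CxVert) ∈ J
    · rw [if_pos hp, if_pos (hmem.2 hp)]
      rfl
    · rw [if_neg hp, if_neg (fun h => hp (hmem.1 h))]
  · rw [if_neg hJ, if_neg (fun h => hJ ((hind J).1 h))]

/-- **Tseitin covariance of the complex factor**: `F_e(y ∘ shift β) = F_{e + Σβ}(y)`. -/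
theorem tg_cxW_shift (lam qp qm : ℝ) (e : ZMod 2) (β : Fin 3 → ZMod 2) (y : Fin 3 × ZMod 2 → Bool) :
    cxW lam qp qm e (fun p => y (p.1, p.2 + β p.1)) = cxW lam qp qm (e + ∑ k, β k) y :=
  congrArg (· / (1 + lam) ^ 10) (tg_cxWeight_shift e lam β (fun p => 1 - occP qp qm (y p)))

/-- Constant configurations weigh the same under both local charges (`cxGraph 1 ≅ cxGraph 0`). -/
theorem tg_cxW_const (lam qp qm : ℝ) (e : ZMod 2) (b : Bool) :
    cxW lam qp qm e (fun _ => b) = cxW lam qp qm 0 (fun _ => b) := by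
  have h := tg_cxW_shift lam qp qm e (fun i => if i = 2 then e else 0) (fun _ => b)
  have h3 : ∑ k : Fin 3, (if k = 2 then e else 0) = e := by simp
  rwa [h3, zmod2_add_self] at h

/-! ## Pair factors, canonical darts, parity over the darts -/

/-- The pair factors: `0 < pairW s t ≤ pairW true false =: A` (`(1-q⁺q⁻)² − (1−q⁺²)(1−q⁻²) = (q⁺−q⁻)²`), and
an aligned pair loses exactly `slyB^{κ₁}`: `pairW s s · slyB^{κ₁} = A`. -/
theorem tg_pairW_facts {qp qm : ℝ} (hqm : 0 < qm) (hlt : qm < qp) (hqp : qp < 1) (κ₁ : ℕ) (s t : Bool) :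
    0 < pairW qp qm κ₁ s t ∧ pairW qp qm κ₁ s t ≤ pairW qp qm κ₁ true false ∧
      pairW qp qm κ₁ s s * slyB qp qm ^ κ₁ = pairW qp qm κ₁ true false := by
  have hqp0 : 0 < qp := hqm.trans hlt
  have hqm1 : qm < 1 := hlt.trans hqp
  have h1 : (1 - qp ^ 2) ≠ 0 := by nlinarith [mul_pos hqp0 hqp0]
  have h2 : (1 - qm ^ 2) ≠ 0 := by nlinarith [mul_pos hqm hqm]
  unfold pairW occP occM Literature.Computability.Complexity.slyB
  refine ⟨?_, ?_, ?_⟩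
  · cases s <;> cases t <;> simp only [if_true, if_false, Bool.false_eq_true] <;> apply pow_pos <;>
      apply mul_pos <;> nlinarith [mul_pos hqm hqp0, mul_pos hqm hqm, mul_pos hqp0 hqp0]
  · cases s <;> cases t <;> simp only [if_true, if_false, Bool.false_eq_true]
    · refine pow_le_pow_left₀ (mul_nonneg ?_ ?_) ?_ κ₁ <;>
        nlinarith [mul_pos hqm hqm, mul_pos hqp0 hqp0, sq_nonneg (qp - qm)]
    · exact le_of_eq (by ring)
    · exact le_rfl
    · refine pow_le_pow_left₀ (mul_nonneg ?_ ?_) ?_ κ₁ <;>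
        nlinarith [mul_pos hqm hqm, mul_pos hqp0 hqp0, sq_nonneg (qp - qm)]
  · rw [← mul_pow]
    congr 1
    cases s <;> simp only [if_true, if_false, Bool.false_eq_true] <;> field_simp

/-- Pointwise comparison of the factors of the pair product with those of its all-anti-aligned value. -/
theorem tg_pairFactor_le (R : RotGraph M 3) {qp qm : ℝ} (hqm : 0 < qm) (hlt : qm < qp) (hqp : qp < 1)
    (κ₁ : ℕ) (Y : Dart M 3 × ZMod 2 → Bool) (δ : Dart M 3) :
    (0 : ℝ) ≤ (if Canon R δ then pairW qp qm κ₁ (Y (δ, 0)) (Y (δ, 1)) else 1) ∧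
      (if Canon R δ then pairW qp qm κ₁ (Y (δ, 0)) (Y (δ, 1)) else 1) ≤
        (if Canon R δ then pairW qp qm κ₁ true false else 1) := by
  split_ifs
  · exact ⟨(tg_pairW_facts hqm hlt hqp κ₁ _ _).1.le, (tg_pairW_facts hqm hlt hqp κ₁ _ _).2.1⟩
  · exact ⟨zero_le_one, le_rfl⟩

/-- Splitting off one factor: if `0 ≤ f ≤ g` pointwise and `f a · r ≤ g a`, then `(Π f) · r ≤ Π g`. -/
theorem tg_prod_mul_le {ι : Type*} [Fintype ι] {f g : ι → ℝ} (a : ι) {r : ℝ} (h0 : ∀ i, 0 ≤ f i)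
    (hle : ∀ i, f i ≤ g i) (ha : f a * r ≤ g a) : (∏ i, f i) * r ≤ ∏ i, g i := by
  rw [← Finset.mul_prod_erase univ f (mem_univ a), ← Finset.mul_prod_erase univ g (mem_univ a),
    mul_right_comm]
  exact mul_le_mul ha (Finset.prod_le_prod (fun i _ => h0 i) fun i _ => hle i)
    (Finset.prod_nonneg fun i _ => h0 i) ((h0 a).trans (hle a))

/-- Every dart end plugs into a canonical dart, the same one for both darts of an edge (no half-edges: a
non-canonical dart lies strictly above its reverse). -/
theorem tg_canonEnd_canon {R : RotGraph M 3} (hR : NoFixed R) (δ : Dart M 3) :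
    Canon R (canonEnd R δ).1 ∧ (canonEnd R (R.rot δ)).1 = (canonEnd R δ).1 := by
  have nc : ∀ δ', ¬ Canon R δ' → Canon R (R.rot δ') := fun δ' h => by
    unfold Canon at h ⊢
    rw [R.rot_rot]
    exact (not_lt.1 h).lt_of_ne fun h' => hR δ' (code_injective h')
  have cn : ∀ δ', Canon R δ' → ¬ Canon R (R.rot δ') := fun δ' h => by
    unfold Canon at h ⊢
    rw [R.rot_rot]
    exact not_lt.2 h.le
  unfold canonEnd
  by_cases h : Canon R δ
  · rw [if_pos h, if_neg (cn δ h), R.rot_rot]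
    exact ⟨h, rfl⟩
  · rw [if_neg h, if_pos (nc δ h)]
    exact ⟨nc δ h, rfl⟩

/-- A dart function that is constant on edges sums to zero over all darts (the darts pair up; `ZMod 2`). -/
theorem tg_sum_darts_eq_zero {R : RotGraph M 3} (hR : NoFixed R) {f : Dart M 3 → ZMod 2}
    (hf : ∀ δ, f (R.rot δ) = f δ) : ∑ δ, f δ = 0 :=
  Finset.sum_ninvolution R.rot (fun δ => by rw [hf, zmod2_add_self]) (fun δ _ => hR δ)
    (fun δ => Finset.mem_univ _) R.rot_rot

/-! ## The complex part of the weight -/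

/-- **Off-diagonal phase vectors.** If every canonical pair is anti-aligned then, with the edge bits `β`
(`β δ = 0` iff the canonical copy of the edge of `δ` is in phase `+`), the complex at `w` reads the reference
configuration shifted by `β (w, ·)` and weighs `exp Ψ(c w + Σ_i β (w, i))` (Tseitin covariance); these local
charges sum to `Σ c = 1`, so some complex is violated, and the complex product times `e^{κ₂ (Ψ(0) − Ψ(1))}`
is at most its reference value. -/
theorem tg_cxProd_anti {R : RotGraph M 3} (hR : NoFixed R) {lam qp qm : ℝ} (hlam : 0 ≤ lam) (hqp : qp ≤ 1)
    (hqm : qm ≤ 1) (hΨ : pwPsi lam qp qm 1 ≤ pwPsi lam qp qm 0) (κ₂ : ℕ) {c : Fin M → ZMod 2}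
    (hc : ∑ w, c w = 1) {Y : Dart M 3 × ZMod 2 → Bool} (hanti : ∀ δ, Canon R δ → Y (δ, 1) = !Y (δ, 0)) :
    (∏ w : Fin M, cxW lam qp qm (c w) (fun p => Y ((canonEnd R (w, p.1)).1, p.2)) ^ κ₂) *
        Real.exp (κ₂ * (pwPsi lam qp qm 0 - pwPsi lam qp qm 1)) ≤
      ∏ _w : Fin M, Real.exp (pwPsi lam qp qm 0) ^ κ₂ := by
  -- the edge bits: constant on edges, hence of total sum zero
  set β : Dart M 3 → ZMod 2 := fun δ => if Y ((canonEnd R δ).1, 0) = true then 0 else 1 with hβ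
  have hβsum : ∑ δ, β δ = 0 :=
    tg_sum_darts_eq_zero hR fun δ => by simp only [hβ, (tg_canonEnd_canon hR δ).2]
  rw [Fintype.sum_prod_type] at hβsum
  -- each complex reads the reference configuration shifted by `β (w, ·)`
  have h10 : (1 : ZMod 2) ≠ 0 := by decide
  have h11 : (1 : ZMod 2) + 1 = 0 := by decide
  have hfac : ∀ w : Fin M, cxW lam qp qm (c w) (fun p => Y ((canonEnd R (w, p.1)).1, p.2)) =
      Real.exp (pwPsi lam qp qm (c w + ∑ i, β (w, i))) := by
    intro w
    rw [tg_exp_pwPsi hlam hqp hqm,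
      ← tg_cxW_shift lam qp qm (c w) (fun i => β (w, i)) (fun q => decide (q.2 = 0))]
    congr 1
    funext ⟨i, a⟩
    have hcan := hanti _ (tg_canonEnd_canon hR (w, i)).1
    simp only [hβ]
    rcases zmod2_eq_zero_or_one a with rfl | rfl <;>
      by_cases h : Y ((canonEnd R (w, i)).1, 0) = true <;> simp [h, h10, h11, hcan]
  -- the local charges sum to `Σ c = 1`, so some complex is violated
  obtain ⟨w₁, hw₁⟩ : ∃ w₁ : Fin M, c w₁ + ∑ i, β (w₁, i) = 1 := by
    by_contra h
    push Not at h
    have hsum : ∑ w, (c w + ∑ i, β (w, i)) = 1 := by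
      rw [Finset.sum_add_distrib, hc, hβsum, add_zero]
    rw [Finset.sum_eq_zero fun w _ => (zmod2_eq_zero_or_one _).resolve_right (h w)] at hsum
    exact zero_ne_one hsum
  -- split off the violated complex (`e^{κ₂ Ψ(1)} · e^{κ₂ g} = e^{κ₂ Ψ(0)}`); the others give `≤ e^{κ₂ Ψ(0)}`
  have hle : ∀ w, Real.exp (pwPsi lam qp qm (c w + ∑ i, β (w, i))) ^ κ₂ ≤
      Real.exp (pwPsi lam qp qm 0) ^ κ₂ := fun w =>
    pow_le_pow_left₀ (Real.exp_pos _).le (Real.exp_le_exp.2 (by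
      rcases zmod2_eq_zero_or_one (c w + ∑ i, β (w, i)) with h | h <;> rw [h]
      exact hΨ)) κ₂
  simp only [hfac]
  refine tg_prod_mul_le w₁ (fun w => by positivity) hle (le_of_eq ?_)
  rw [hw₁, ← Real.exp_nat_mul, ← Real.exp_nat_mul, ← Real.exp_add]
  congr 1
  ring

/-- **Any phase vector.** Every complex factor is at most the all-`−` factor `F_max` (the same for both
charges), the reference factor `e^{Ψ(0)}` is at least the all-`+` factor `F_min`, `ρ_F = F_max / F_min`, and
the coupling hypothesis turns `F_max^{κ₂ M} e^{κ₂ g}` into `slyB^{κ₁} (e^{Ψ(0)})^{κ₂ M}`. -/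
theorem tg_cxProd_general {lam qp qm : ℝ} (hlam : 0 ≤ lam) (hqm : 0 < qm) (hlt : qm < qp) (hqp : qp < 1)
    {κ₁ κ₂ : ℕ}
    (hcouple : (κ₂ : ℝ) * (M * Real.log (cxRho lam qp qm) + (pwPsi lam qp qm 0 - pwPsi lam qp qm 1)) ≤
      κ₁ * Real.log (slyB qp qm))
    (c : Fin M → ZMod 2) (y : Fin M → Fin 3 × ZMod 2 → Bool) :
    (∏ w, cxW lam qp qm (c w) (y w) ^ κ₂) * Real.exp (κ₂ * (pwPsi lam qp qm 0 - pwPsi lam qp qm 1)) ≤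
      slyB qp qm ^ κ₁ * ∏ _w : Fin M, Real.exp (pwPsi lam qp qm 0) ^ κ₂ := by
  have hqp1 : qp ≤ 1 := hqp.le
  have hqm1 : qm ≤ 1 := (hlt.trans hqp).le
  have hpos := tg_cxW_pos hlam hqp1 hqm1
  have hB : 0 < slyB qp qm := zero_lt_one.trans (one_lt_slyB hqm hlt hqp)
  -- every factor is at most `F_max`
  have h1 : ∏ w, cxW lam qp qm (c w) (y w) ^ κ₂ ≤ ∏ _w : Fin M, cxW lam qp qm 0 (fun _ => false) ^ κ₂ :=
    Finset.prod_le_prod (fun w _ => pow_nonneg (hpos _ _).le _) fun w _ =>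
      pow_le_pow_left₀ (hpos _ _).le
        ((tg_cxW_bounds hlam hlt.le hqp1 _ _).2.trans_eq (tg_cxW_const lam qp qm (c w) false)) κ₂
  refine (mul_le_mul_of_nonneg_right h1 (Real.exp_pos _).le).trans ?_
  -- in logarithms
  have hρ : Real.log (cxRho lam qp qm) =
      Real.log (cxW lam qp qm 0 fun _ => false) - Real.log (cxW lam qp qm 0 fun _ => true) :=
    Real.log_div (hpos _ _).ne' (hpos _ _).ne'
  have hmin : Real.log (cxW lam qp qm 0 fun _ => true) ≤ pwPsi lam qp qm 0 :=
    Real.log_le_log (hpos _ _) (tg_cxW_bounds hlam hlt.le hqp1 0 _).1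
  rw [Finset.prod_const, Finset.prod_const, Finset.card_univ, Fintype.card_fin,
    ← Real.exp_log (hpos 0 fun _ => false), ← Real.exp_log hB]
  simp only [← Real.exp_nat_mul, ← Real.exp_add, Real.exp_le_exp]
  rw [hρ] at hcouple
  nlinarith [mul_le_mul_of_nonneg_left hmin (by positivity : (0 : ℝ) ≤ (M : ℝ) * (κ₂ : ℝ))]

/-! ## The theorem -/

/-- **S6 — the Tseitin energy gap** (`stub_tseitinGap` of the line `parity-wired-ports`). Over a base without
half-edges, if the pair coupling dominates (`κ₂ (M log ρ_F + g) ≤ κ₁ log B`, `g = Ψ(0) − Ψ(1) ≥ 0`), the weight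
of EVERY phase vector under the odd charge `1_{w₀}` times `e^{κ₂ g}` is at most the weight of the reference
vector `Y₀ ≡ (a = 0)` under the charge `0`. All canonical pairs anti-aligned: the pair product is at most its
reference value and `tg_cxProd_anti`; some canonical pair aligned: the pair product loses `slyB^{κ₁}`
(`tg_pairW_facts`) and `tg_cxProd_general`. -/
theorem stub_tseitinGap {R : RotGraph M 3} (hR : NoFixed R) {lam qp qm : ℝ} (hlam : 0 < lam)
    (hqm : 0 < qm) (hlt : qm < qp) (hqp : qp < 1) (hΨ : pwPsi lam qp qm 1 ≤ pwPsi lam qp qm 0) {κ₁ κ₂ : ℕ}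
    (hcouple : (κ₂ : ℝ) * (M * Real.log (cxRho lam qp qm) + (pwPsi lam qp qm 0 - pwPsi lam qp qm 1)) ≤
      κ₁ * Real.log (slyB qp qm)) (w₀ : Fin M) :
    ∃ Y₀ : Dart M 3 × ZMod 2 → Bool, ∀ Y : Dart M 3 × ZMod 2 → Bool,
      pwW R lam qp qm κ₁ κ₂ (Pi.single w₀ 1) Y *
          Real.exp (κ₂ * (pwPsi lam qp qm 0 - pwPsi lam qp qm 1)) ≤
        pwW R lam qp qm κ₁ κ₂ 0 Y₀ := by
  have hqp1 : qp ≤ 1 := hqp.le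
  have hqm1 : qm ≤ 1 := (hlt.trans hqp).le
  refine ⟨fun g => decide (g.2 = 0), fun Y => ?_⟩
  -- the reference value: `pwW 0 Y₀ = Π_{canonical} A · Π_w (e^{Ψ(0)})^{κ₂}`
  have h1 : decide ((1 : ZMod 2) = 0) = false := by decide
  unfold pwW
  simp only [h1, decide_true, Pi.zero_apply, ← tg_exp_pwPsi hlam.le hqp1 hqm1]
  set P := ∏ δ : Dart M 3, if Canon R δ then pairW qp qm κ₁ (Y (δ, 0)) (Y (δ, 1)) else 1
  set P₀ := ∏ δ : Dart M 3, if Canon R δ then pairW qp qm κ₁ true false else 1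
  set Q := ∏ w : Fin M, cxW lam qp qm ((Pi.single w₀ 1 : Fin M → ZMod 2) w)
    (fun p => Y ((canonEnd R (w, p.1)).1, p.2)) ^ κ₂
  set Q₀ := ∏ _w : Fin M, Real.exp (pwPsi lam qp qm 0) ^ κ₂
  set E := Real.exp (κ₂ * (pwPsi lam qp qm 0 - pwPsi lam qp qm 1))
  have hf := tg_pairFactor_le R hqm hlt hqp κ₁ Y
  have hP : 0 ≤ P ∧ P ≤ P₀ :=
    ⟨Finset.prod_nonneg fun δ _ => (hf δ).1, Finset.prod_le_prod (fun δ _ => (hf δ).1) fun δ _ => (hf δ).2⟩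
  have hQ₀ : 0 ≤ Q₀ := Finset.prod_nonneg fun w _ => by positivity
  by_cases hanti : ∀ δ, Canon R δ → Y (δ, 1) = !Y (δ, 0)
  · -- all canonical pairs anti-aligned: `P ≤ P₀` and `Q · E ≤ Q₀`
    have hc : ∑ w, (Pi.single w₀ 1 : Fin M → ZMod 2) w = 1 := by simp
    calc P * Q * E = P * (Q * E) := mul_assoc _ _ _
      _ ≤ P₀ * Q₀ := mul_le_mul hP.2 (tg_cxProd_anti hR hlam.le hqp1 hqm1 hΨ κ₂ hc hanti)
          (mul_nonneg (Finset.prod_nonneg fun w _ => pow_nonneg (tg_cxW_pos hlam.le hqp1 hqm1 _ _).le _)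
            (Real.exp_pos _).le) (hP.1.trans hP.2)
  · -- some canonical pair `δ₀` aligned: `P · B^{κ₁} ≤ P₀` and `Q · E ≤ B^{κ₁} · Q₀`
    push Not at hanti
    obtain ⟨δ₀, hδ₀, hal⟩ := hanti
    have hal' : Y (δ₀, 1) = Y (δ₀, 0) := by
      revert hal
      cases Y (δ₀, 0) <;> cases Y (δ₀, 1) <;> decide
    have h1 : P * slyB qp qm ^ κ₁ ≤ P₀ :=
      tg_prod_mul_le δ₀ (fun δ => (hf δ).1) (fun δ => (hf δ).2) (by
        rw [if_pos hδ₀, if_pos hδ₀, hal']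
        exact (tg_pairW_facts hqm hlt hqp κ₁ (Y (δ₀, 0)) true).2.2.le)
    have h2 : Q * E ≤ slyB qp qm ^ κ₁ * Q₀ :=
      tg_cxProd_general hlam.le hqm hlt hqp hcouple (Pi.single w₀ 1)
        fun w p => Y ((canonEnd R (w, p.1)).1, p.2)
    calc P * Q * E = P * (Q * E) := mul_assoc _ _ _
      _ ≤ P * (slyB qp qm ^ κ₁ * Q₀) := mul_le_mul_of_nonneg_left h2 hP.1
      _ = P * slyB qp qm ^ κ₁ * Q₀ := by ring
      _ ≤ P₀ * Q₀ := mul_le_mul_of_nonneg_right h1 hQ₀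

end Summit.PneNP.PneNP.Cruxes.PolyDepthTwinsAbove.ParityWiredPorts
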